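import Literature.Topology.FourManifolds.DehnSurgeryTwistProofs
import Literature.Topology.FourManifolds.CircleSurgeryExistence
import HarnessLib

/-!
# The cone over a tubular neighbourhood of a knot

Topic `Literature/Topology/FourManifolds`; fact seat of
`Literature.Topology.FourManifolds.Knot.ManolescuPiccirillo2023_lemma33_sphere` (Manolescu–Piccirillo (2023),
Lemma 3.3 for `W = S⁴`). For an oriented tubular neighbourhood `ν : 𝕊¹ × ℝ² ↪ 𝕊³` of a knot `K`
(`Knot.TubularNbhd K`) the **cone tube**

  `ν.coneTube (x, w) = ‖x‖ • ν(x/‖x‖, w) ∈ ℝ⁴`    (`x ∈ ℝ² ∖ 0`, `w ∈ ℝ²`)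

is the radial extension of `ν` into the ball: on the punctured plane times the fibre it is a `C^∞`
injective immersion of the `4`-manifold `(ℝ² ∖ 0) × ℝ²` into `ℝ⁴` (`contDiffOn_coneTube`,
`injOn_coneTube`, `injective_fderiv_coneTube`), homogeneous in the first variable
(`coneTube_smul_fst`), of norm `‖x‖` (`norm_coneTube`), and equal to the cone `‖x‖ • K(x/‖x‖)` on the
zero section (`coneTube_fst_zero`). This is the shape, near the boundary sphere, of the trivialised
tubular neighbourhood `G` of a slice disc which is conical near `𝕊³` demanded by the named fact
`Knot.IsSliceDisc.exists_conicalTube_hasFraming_zero` (`SliceDiscEndCollarFacts.lean`):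
`G(x, w) = ‖x‖ • ν(x/‖x‖, w)` for `1 - s₁ < ‖x‖ < 1`.

The immersion property is read off the orientation field `det_pos` of `ν`: at `(t • u, w)`,
`u = circlePoint θ`, `t > 0`, the differential of the cone tube hits the four rows
`ν(u, w), ∂_θ ν, t ∂_{w₀} ν, t ∂_{w₁} ν` of the Jacobian frame of the coordinate expression
`ν.coordMap` (`DehnSurgeryTwistProofs.lean`), whose determinant is `tubeFrameDet ν.coordMap (θ, w) > 0`;
four independent vectors in the image of a linear map `ℝ² × ℝ² → ℝ⁴` make it bijective.

## Intended use (the discharge of `Knot.IsSliceDisc.exists_conicalTube_hasFraming_zero`)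

Given a slice disc `g₁` of `K`, conical on `1 - s₁ ≤ ‖x‖ ≤ 1`, the tube `G` of that fact is obtained
from two classical inputs — (i) a transversal framing `n₀, n₁ : D̊² → ℝ⁴` of the disc which over a band
`1 - s₂ < ‖x‖ < 1`, `s₂ > s₁`, is the cone `nᵢ(t • u) = t • ∂_{wᵢ}|₀ ν(u, ·)` on the fibre derivative of
some oriented tubular neighbourhood `ν` of `K` (trivial normal bundle of a disc and a *neat* tubular
neighbourhood, Kosinski (1993), Ch. III (4.1)–(4.2)), and (ii) the fact that such a `ν` has framing `0`
(Kirby (1989), Ch. I §2, p. 6: the zero framing is the one extending over the normal bundle of a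
surface in `B⁴` bounded by the knot) — by blending the affine tube `A(x, w) = g₁ x + ∑ wᵢ nᵢ x` (deep)
into `ν.coneTube (x, w) + (g₁ x - ν.coneTube (x, 0))` (near the band; the correction vanishes
identically on the conical band) with a cutoff in `‖x‖` supported strictly inside `1 - s₂ < ‖x‖ < 1 - s₁`,
where both pieces have the same fibre derivative `nᵢ` along the zero section; injectivity on a thin tube
is `exists_injOn_prod_ball` (`FramedTubularNbhd.lean`), the immersion property off the deep part is
`injective_fderiv_coneTube`, and thinning the fibres is `Knot.TubularNbhd.scale`
(`KirbyMovesShrinkProofs.lean`, framing preserved: `HasFraming.scale`).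

## References

* A. A. Kosinski, *Differential Manifolds*, Academic Press (1993), Ch. III (4.1)–(4.2) (neat tubular
  neighbourhoods), Ch. VI §1 (cones and collars in gluings). [cite: Kosinski1993, Ch. III Thm (4.2)]
* R. C. Kirby, *The Topology of 4-Manifolds*, LNM 1374 (1989), Ch. I §2, p. 6. [cite: Kirby1989, Ch. I §2]
* C. Manolescu, L. Piccirillo, *From zero surgeries to candidates for exotic definite 4-manifolds*,
  J. London Math. Soc. (2023), proof of Lemma 3.3. [cite: ManolescuPiccirillo2023, proof of Lemma 3.3]

## Design notes

* `coneTube` is a bare function `ℝ² × ℝ² → ℝ⁴` with the junk value `0` on `x = 0` (from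
  `radialProjection` and the factor `‖x‖`), so that homogeneity `coneTube (t • x, w) = t • coneTube (x, w)`
  holds for all `x` and the consumer's formulas are plain vector algebra.
* No declaration in this file uses `sorry`; notation `𝔼 n`, `𝕊 n` is local.
-/

noncomputable section

open Set Metric Function Filter
open scoped Manifold ContDiff Topology

namespace Literature.Topology.FourManifolds

/-- Local notation: `𝔼 n` is the model Euclidean space `EuclideanSpace ℝ (Fin n)`. -/
local notation "𝔼 " n:arg => EuclideanSpace ℝ (Fin n)

/-- Local notation: `𝕊 n` is the unit sphere in `EuclideanSpace ℝ (Fin (n + 1))`. -/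
local notation "𝕊 " n:arg => (Metric.sphere (0 : EuclideanSpace ℝ (Fin (n + 1))) 1)

attribute [local instance] fact_finrank_euclideanSpace_two fact_finrank_euclideanSpace_four

/-! ### Four vectors with nonzero determinant are linearly independent -/

/-- If `frameDet r₀ r₁ r₂ r₃ ≠ 0` then `r₀, r₁, r₂, r₃` are linearly independent (all four
coefficients of a vanishing linear combination vanish). [folklore] -/
theorem eq_zero_of_frameDet_ne_zero₄ {r₀ r₁ r₂ r₃ : 𝔼 4} (h : frameDet r₀ r₁ r₂ r₃ ≠ 0)
    {a b c d : ℝ} (h0 : a • r₀ + b • r₁ + c • r₂ + d • r₃ = 0) :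
    a = 0 ∧ b = 0 ∧ c = 0 ∧ d = 0 := by
  by_contra hne
  apply h
  unfold frameDet
  rw [← Matrix.exists_vecMul_eq_zero_iff]
  refine ⟨![a, b, c, d], ?_, ?_⟩
  · intro h'
    apply hne
    refine ⟨?_, ?_, ?_, ?_⟩
    · simpa using congrFun h' 0
    · simpa using congrFun h' 1
    · simpa using congrFun h' 2
    · simpa using congrFun h' 3
  · funext j
    have := congrArg (fun x : 𝔼 4 ↦ x j) h0
    simp at this
    simp [Matrix.vecMul, dotProduct, Fin.sum_univ_succ]
    linarith

/-- Linear independence, as a `LinearIndependent` statement, of four vectors of `ℝ⁴` with nonzero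
determinant. [folklore] -/
theorem linearIndependent_of_frameDet_ne_zero {r₀ r₁ r₂ r₃ : 𝔼 4} (h : frameDet r₀ r₁ r₂ r₃ ≠ 0) :
    LinearIndependent ℝ ![r₀, r₁, r₂, r₃] := by
  rw [Fintype.linearIndependent_iff]
  intro g hg i
  rw [Fin.sum_univ_four] at hg
  simp only [Matrix.cons_val_zero, Matrix.cons_val_one, Matrix.cons_val] at hg
  obtain ⟨h0, h1, h2, h3⟩ := eq_zero_of_frameDet_ne_zero₄ h hg
  fin_cases i <;> assumption

/-- A continuous linear map `ℝ² × ℝ² → ℝ⁴` whose image contains four vectors with nonzero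
determinant is injective (it is onto, and the dimensions agree). [folklore] -/
theorem injective_of_frameDet_ne_zero_of_mem_range {D : (𝔼 2) × (𝔼 2) →L[ℝ] 𝔼 4}
    {r₀ r₁ r₂ r₃ : 𝔼 4} (h : frameDet r₀ r₁ r₂ r₃ ≠ 0)
    (h₀ : r₀ ∈ LinearMap.range (D : (𝔼 2) × (𝔼 2) →ₗ[ℝ] 𝔼 4))
    (h₁ : r₁ ∈ LinearMap.range (D : (𝔼 2) × (𝔼 2) →ₗ[ℝ] 𝔼 4))
    (h₂ : r₂ ∈ LinearMap.range (D : (𝔼 2) × (𝔼 2) →ₗ[ℝ] 𝔼 4))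
    (h₃ : r₃ ∈ LinearMap.range (D : (𝔼 2) × (𝔼 2) →ₗ[ℝ] 𝔼 4)) : Injective D := by
  have hli := linearIndependent_of_frameDet_ne_zero h
  have hspan : Submodule.span ℝ (Set.range ![r₀, r₁, r₂, r₃]) = ⊤ :=
    hli.span_eq_top_of_card_eq_finrank' (by simp)
  have hrange : LinearMap.range (D : (𝔼 2) × (𝔼 2) →ₗ[ℝ] 𝔼 4) = ⊤ := by
    rw [eq_top_iff, ← hspan, Submodule.span_le, Set.range_subset_iff]
    intro i
    fin_cases i
    · exact h₀
    · exact h₁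
    · exact h₂
    · exact h₃
  have hsurj : Surjective (D : (𝔼 2) × (𝔼 2) →ₗ[ℝ] 𝔼 4) := LinearMap.range_eq_top.1 hrange
  have hdim : Module.finrank ℝ ((𝔼 2) × (𝔼 2)) = Module.finrank ℝ (𝔼 4) := by
    simp [Module.finrank_prod]
  have hinj := (LinearMap.injective_iff_surjective_of_finrank_eq_finrank hdim).2 hsurj
  exact hinj

namespace Knot.TubularNbhd

variable {K : 𝕊 1 → 𝕊 3} (ν : Knot.TubularNbhd K)

/-! ### The cone tube and its algebra -/

/-- The **cone tube** of an oriented tubular neighbourhood `ν` of a knot: the radial extension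
`(x, w) ↦ ‖x‖ • ν(x/‖x‖, w)` of `ν : 𝕊¹ × ℝ² → 𝕊³` to `ℝ² × ℝ² → ℝ⁴` (junk value `0` on `x = 0`). Near
the boundary sphere this is the trivialised tubular neighbourhood of a slice disc which is the cone on
the knot there (Kosinski (1993), Ch. III (4.1): a *neat* tubular neighbourhood). [folklore] -/
def coneTube (q : (𝔼 2) × (𝔼 2)) : 𝔼 4 :=
  ‖q.1‖ • ((ν (radialProjection (spherePt 1) q.1, q.2) : 𝕊 3) : 𝔼 4)

/-- Unfolding of the cone tube. [folklore] -/
theorem coneTube_apply (x w : 𝔼 2) :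
    ν.coneTube (x, w) = ‖x‖ • ((ν (radialProjection (spherePt 1) x, w) : 𝕊 3) : 𝔼 4) := rfl

/-- The cone tube on a cone point `(t • u, w)`, `u ∈ 𝕊¹`, `t > 0`: `t • ν(u, w)`. [folklore] -/
theorem coneTube_smul_coe {t : ℝ} (ht : 0 < t) (u : 𝕊 1) (w : 𝔼 2) :
    ν.coneTube (t • (u : 𝔼 2), w) = t • ((ν (u, w) : 𝕊 3) : 𝔼 4) := by
  rw [coneTube_apply, radialProjection_smul _ ht, norm_smul_coe_sphere ht.le]

/-- On the unit circle the cone tube is `ν`. [folklore] -/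
theorem coneTube_coe (u : 𝕊 1) (w : 𝔼 2) :
    ν.coneTube ((u : 𝔼 2), w) = ((ν (u, w) : 𝕊 3) : 𝔼 4) := by
  simpa using ν.coneTube_smul_coe one_pos u w

/-- The cone tube has norm `‖x‖` (the tube lies on the unit sphere). [folklore] -/
@[simp]
theorem norm_coneTube (q : (𝔼 2) × (𝔼 2)) : ‖ν.coneTube q‖ = ‖q.1‖ := by
  rw [coneTube, norm_smul, norm_norm, norm_eq_of_mem_sphere, mul_one]

/-- The junk value on `x = 0`. [folklore] -/
@[simp]
theorem coneTube_zero_fst (w : 𝔼 2) : ν.coneTube (0, w) = 0 := by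
  simp [coneTube_apply]

/-- **Homogeneity** of the cone tube in the first variable: `coneTube (t • x, w) = t • coneTube (x, w)`
for `t > 0` (all `x`, thanks to the junk value). [folklore] -/
theorem coneTube_smul_fst {t : ℝ} (ht : 0 < t) (x w : 𝔼 2) :
    ν.coneTube (t • x, w) = t • ν.coneTube (x, w) := by
  by_cases hx : x = 0
  · simp [hx]
  · have hx0 : 0 < ‖x‖ := norm_pos_iff.2 hx
    conv_lhs => rw [← norm_smul_coe_radialProjection (spherePt 1) x, smul_smul]
    rw [ν.coneTube_smul_coe (mul_pos ht hx0), mul_smul, ← ν.coneTube_smul_coe hx0,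
      norm_smul_coe_radialProjection]

/-- **On the zero section the cone tube is the cone on the knot**: `coneTube (t • u, 0) = t • K u`.
[folklore] -/
theorem coneTube_smul_coe_zero {t : ℝ} (ht : 0 < t) (u : 𝕊 1) :
    ν.coneTube (t • (u : 𝔼 2), 0) = t • ((K u : 𝕊 3) : 𝔼 4) := by
  rw [ν.coneTube_smul_coe ht, ν.coe_apply_zero]

/-- On the zero section, in Cartesian form: `coneTube (x, 0) = ‖x‖ • K(x/‖x‖)`. [folklore] -/
theorem coneTube_fst_zero (x : 𝔼 2) :
    ν.coneTube (x, 0) = ‖x‖ • ((K (radialProjection (spherePt 1) x) : 𝕊 3) : 𝔼 4) := by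
  rw [coneTube_apply, ν.coe_apply_zero]

/-- The cone tube maps `D̊² × ℝ²` into the open unit ball. [folklore] -/
theorem coneTube_mem_ball {q : (𝔼 2) × (𝔼 2)} (hq : ‖q.1‖ < 1) : ν.coneTube q ∈ ball (0 : 𝔼 4) 1 := by
  rwa [mem_ball_zero_iff, norm_coneTube]

/-- **The cone tube is injective off `x = 0`** (norms recover `‖x‖`, then `ν` is injective).
[folklore] -/
theorem injOn_coneTube : InjOn ν.coneTube {q : (𝔼 2) × (𝔼 2) | q.1 ≠ 0} := by
  rintro ⟨x, w⟩ hx ⟨x', w'⟩ - h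
  have hn : ‖x‖ = ‖x'‖ := by simpa using congrArg norm h
  have hx0 : 0 < ‖x‖ := norm_pos_iff.2 hx
  rw [coneTube_apply, coneTube_apply, ← hn] at h
  have h2 : ((ν (radialProjection (spherePt 1) x, w) : 𝕊 3) : 𝔼 4) =
      ((ν (radialProjection (spherePt 1) x', w') : 𝕊 3) : 𝔼 4) := smul_right_injective (𝔼 4) hx0.ne' h
  obtain ⟨hu, hw⟩ := Prod.mk.inj (ν.injective (Subtype.ext h2))
  refine Prod.ext ?_ hw
  change x = x'
  rw [← norm_smul_coe_radialProjection (spherePt 1) x, ← norm_smul_coe_radialProjection (spherePt 1) x',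
    hu, hn]

/-! ### Smoothness -/

/-- **The cone tube is `C^∞` off `x = 0`.** [folklore] -/
theorem contDiffOn_coneTube : ContDiffOn ℝ ∞ ν.coneTube {q : (𝔼 2) × (𝔼 2) | q.1 ≠ 0} := by
  have hfst : ContMDiff 𝓘(ℝ, (𝔼 2) × (𝔼 2)) 𝓘(ℝ, 𝔼 2) ∞ (Prod.fst : (𝔼 2) × (𝔼 2) → 𝔼 2) :=
    contDiff_fst.contMDiff
  have hsnd : ContMDiff 𝓘(ℝ, (𝔼 2) × (𝔼 2)) 𝓘(ℝ, 𝔼 2) ∞ (Prod.snd : (𝔼 2) × (𝔼 2) → 𝔼 2) :=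
    contDiff_snd.contMDiff
  have hP : ContMDiffOn 𝓘(ℝ, (𝔼 2) × (𝔼 2)) ((𝓡 1).prod 𝓘(ℝ, 𝔼 2)) ∞
      (fun p : (𝔼 2) × (𝔼 2) ↦ (radialProjection (spherePt 1) p.1, p.2)) {p | p.1 ≠ 0} :=
    ((contMDiffOn_radialProjection (spherePt 1)).comp hfst.contMDiffOn fun p hp ↦ hp).prodMk
      hsnd.contMDiffOn
  have hν : ContMDiffOn 𝓘(ℝ, (𝔼 2) × (𝔼 2)) 𝓘(ℝ, 𝔼 4) ∞
      (fun p : (𝔼 2) × (𝔼 2) ↦ ((ν (radialProjection (spherePt 1) p.1, p.2) : 𝕊 3) : 𝔼 4))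
      {p | p.1 ≠ 0} :=
    ((contMDiff_coe_sphere (E := 𝔼 4) (n := 3)).comp ν.contMDiff).comp_contMDiffOn hP
  have h3 : ContMDiffOn 𝓘(ℝ, (𝔼 2) × (𝔼 2)) 𝓘(ℝ, ℝ) ∞ (fun p : (𝔼 2) × (𝔼 2) ↦ ‖p.1‖)
      {p | p.1 ≠ 0} := by
    intro p hp
    have : ContDiffAt ℝ ∞ (fun p : (𝔼 2) × (𝔼 2) ↦ ‖p.1‖) p :=
      (contDiffAt_norm ℝ (hp : p.1 ≠ 0)).comp p contDiffAt_fst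
    exact this.contMDiffAt.contMDiffWithinAt
  have hsm : ContDiff ℝ ∞ (fun p : ℝ × (𝔼 4) ↦ p.1 • p.2) := contDiff_fst.smul contDiff_snd
  exact contMDiffOn_iff_contDiffOn.1 (hsm.contMDiff.comp_contMDiffOn (h3.prodMk_space hν))

/-- The set `{x ≠ 0}` (first coordinate nonzero) is open. [folklore] -/
theorem isOpen_fst_ne_zero : IsOpen {q : (𝔼 2) × (𝔼 2) | q.1 ≠ 0} :=
  isOpen_ne_fun continuous_fst continuous_const

/-- The cone tube is `C^∞` at every point with `x ≠ 0`. [folklore] -/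
theorem contDiffAt_coneTube {q : (𝔼 2) × (𝔼 2)} (hq : q.1 ≠ 0) : ContDiffAt ℝ ∞ ν.coneTube q :=
  ν.contDiffOn_coneTube.contDiffAt (isOpen_fst_ne_zero.mem_nhds hq)

/-- The cone tube is continuous off `x = 0`. [folklore] -/
theorem continuousOn_coneTube : ContinuousOn ν.coneTube {q : (𝔼 2) × (𝔼 2) | q.1 ≠ 0} :=
  ν.contDiffOn_coneTube.continuousOn

/-- Every point of the circle is a `circlePoint`. [folklore] -/
theorem exists_circlePoint_eq (u : 𝕊 1) : ∃ θ : ℝ, circlePoint θ = u :=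
  circlePoint_surjective u

/-- **The fibre maps of `ν` are `C^∞`** as maps `ℝ² → ℝ⁴`. [folklore] -/
theorem contDiff_coe_fibre (u : 𝕊 1) : ContDiff ℝ ∞ fun w : 𝔼 2 ↦ ((ν (u, w) : 𝕊 3) : 𝔼 4) := by
  obtain ⟨θ, rfl⟩ := exists_circlePoint_eq u
  have hpair : ContDiff ℝ ∞ fun w : 𝔼 2 ↦ ((θ, w) : ℝ × 𝔼 2) := contDiff_prodMk_right θ
  have h : ContDiff ℝ ∞ fun w : 𝔼 2 ↦ ν.coordMap (θ, w) := ν.contDiff_coordMap.comp hpair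
  simpa only [coordMap_apply] using h

/-- **The fibre derivative of the cone tube** over a cone point is `t` times that of `ν`:
`∂_w (coneTube (t • u, ·)) = t • ∂_w ν(u, ·)`. [folklore] -/
theorem fderiv_coneTube_fibre {t : ℝ} (ht : 0 < t) (u : 𝕊 1) (w : 𝔼 2) :
    fderiv ℝ (fun w' : 𝔼 2 ↦ ν.coneTube (t • (u : 𝔼 2), w')) w =
      t • fderiv ℝ (fun w' : 𝔼 2 ↦ ((ν (u, w') : 𝕊 3) : 𝔼 4)) w := by
  have : (fun w' : 𝔼 2 ↦ ν.coneTube (t • (u : 𝔼 2), w')) =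
      fun w' ↦ t • ((ν (u, w') : 𝕊 3) : 𝔼 4) := funext fun w' ↦ ν.coneTube_smul_coe ht u w'
  rw [this, fderiv_fun_const_smul (((ν.contDiff_coe_fibre u).differentiable (by simp)) w) t]

/-! ### The cone tube is an immersion off `x = 0` -/

/-- **The differential of the cone tube is injective off `x = 0`.** At `(t • u, w)` with
`u = circlePoint θ`, `t > 0`, differentiating along the radius, the angle and the two fibre directions
shows that the image of the differential contains `ν(u, w)`, `∂_θ ν`, `∂_{w₀} ν`, `∂_{w₁} ν` (the
Jacobian frame of `ν.coordMap` at `(θ, w)`), four vectors of positive determinant by `det_pos`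
(`tubeFrameDet_coordMap_pos`); so the differential is onto `ℝ⁴`, hence injective. [folklore] -/
theorem injective_fderiv_coneTube {q : (𝔼 2) × (𝔼 2)} (hq : q.1 ≠ 0) :
    Injective (fderiv ℝ ν.coneTube q) := by
  obtain ⟨x, w⟩ := q
  change x ≠ 0 at hq
  set t : ℝ := ‖x‖ with ht_def
  have ht : 0 < t := norm_pos_iff.2 hq
  obtain ⟨θ, hθ⟩ := exists_circlePoint_eq (radialProjection (spherePt 1) x)
  have hx : t • ((circlePoint θ : 𝕊 1) : 𝔼 2) = x := by
    rw [hθ, ht_def]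
    exact norm_smul_coe_radialProjection _ x
  set D : (𝔼 2) × (𝔼 2) →L[ℝ] 𝔼 4 := fderiv ℝ ν.coneTube (x, w) with hD_def
  have hD : HasFDerivAt ν.coneTube D (x, w) :=
    ((ν.contDiffAt_coneTube hq).differentiableAt (by simp)).hasFDerivAt
  -- the Jacobian frame of the coordinate expression at `(θ, w)`
  set G : ℝ × 𝔼 2 → 𝔼 4 := ν.coordMap with hG_def
  set e₀ : 𝔼 2 := EuclideanSpace.single 0 (1 : ℝ) with he₀
  set e₁ : 𝔼 2 := EuclideanSpace.single 1 (1 : ℝ) with he₁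
  set R₁ : 𝔼 4 := G (θ, w) with hR₁
  set R₂ : 𝔼 4 := fderiv ℝ G (θ, w) (1, 0) with hR₂
  set R₃ : 𝔼 4 := fderiv ℝ G (θ, w) (0, e₀) with hR₃
  set R₄ : 𝔼 4 := fderiv ℝ G (θ, w) (0, e₁) with hR₄
  have hdet : frameDet R₁ R₂ R₃ R₄ ≠ 0 := by
    have := ν.tubeFrameDet_coordMap_pos θ w
    rw [tubeFrameDet_def] at this
    exact this.ne'
  have hGd : ∀ p : ℝ × 𝔼 2, HasFDerivAt G (fderiv ℝ G p) p := fun p ↦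
    (ν.differentiable_coordMap p).hasFDerivAt
  -- the cone tube along the four coordinate curves through `(x, w)`
  have hcone : ∀ (s : ℝ) (w' : 𝔼 2), ν.coneTube (t • ((circlePoint s : 𝕊 1) : 𝔼 2), w') = t • G (s, w') :=
    fun s w' ↦ ν.coneTube_smul_coe ht _ _
  -- (1) the radial direction: `D (u, 0) = ν(u, w)`
  have h1 : D (((circlePoint θ : 𝕊 1) : 𝔼 2), 0) = R₁ := by
    set γ : ℝ → (𝔼 2) × (𝔼 2) := fun s ↦ ((t + s) • ((circlePoint θ : 𝕊 1) : 𝔼 2), w) with hγ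
    have hγ0 : γ 0 = (x, w) := by simp [hγ, hx]
    have hγ' : HasDerivAt γ ((((circlePoint θ : 𝕊 1) : 𝔼 2)), (0 : 𝔼 2)) 0 := by
      have h := (((hasDerivAt_id (0 : ℝ)).const_add t).smul_const
        ((circlePoint θ : 𝕊 1) : 𝔼 2)).prodMk (hasDerivAt_const (0 : ℝ) w)
      simpa [hγ] using h
    have hcomp : HasDerivAt (ν.coneTube ∘ γ) (D (((circlePoint θ : 𝕊 1) : 𝔼 2), 0)) 0 := by
      have hD' : HasFDerivAt ν.coneTube D (γ 0) := by rw [hγ0]; exact hD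
      exact hD'.comp_hasDerivAt 0 hγ'
    have hexp : HasDerivAt (ν.coneTube ∘ γ) R₁ 0 := by
      have heq : (fun s : ℝ ↦ (t + s) • R₁) =ᶠ[𝓝 0] (ν.coneTube ∘ γ) := by
        filter_upwards [Ioi_mem_nhds (show -t < 0 by linarith)] with s hs
        change (t + s) • R₁ = ν.coneTube ((t + s) • ((circlePoint θ : 𝕊 1) : 𝔼 2), w)
        rw [ν.coneTube_smul_coe (by linarith [mem_Ioi.1 hs]), hR₁, hG_def, coordMap_apply]
      have h := ((hasDerivAt_id (0 : ℝ)).const_add t).smul_const R₁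
      rw [one_smul] at h
      exact h.congr_of_eventuallyEq heq.symm
    exact hcomp.unique hexp
  -- (2) the angular direction: `D (t • ∂_θ u, 0) = t • ∂_θ ν`
  have h2 : D (t • deriv (fun s : ℝ ↦ ((circlePoint s : 𝕊 1) : 𝔼 2)) θ, 0) = t • R₂ := by
    set γ : ℝ → (𝔼 2) × (𝔼 2) := fun s ↦ (t • ((circlePoint s : 𝕊 1) : 𝔼 2), w) with hγ
    have hγ0 : γ θ = (x, w) := by simp [hγ, hx]
    have hcp : HasDerivAt (fun s : ℝ ↦ ((circlePoint s : 𝕊 1) : 𝔼 2))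
        (deriv (fun s : ℝ ↦ ((circlePoint s : 𝕊 1) : 𝔼 2)) θ) θ :=
      ((contDiff_coe_circlePoint.differentiable (by simp)) θ).hasDerivAt
    have hγ' : HasDerivAt γ (t • deriv (fun s : ℝ ↦ ((circlePoint s : 𝕊 1) : 𝔼 2)) θ, (0 : 𝔼 2)) θ :=
      (hcp.const_smul t).prodMk (hasDerivAt_const θ w)
    have hcomp : HasDerivAt (ν.coneTube ∘ γ)
        (D (t • deriv (fun s : ℝ ↦ ((circlePoint s : 𝕊 1) : 𝔼 2)) θ, 0)) θ := by
      have hD' : HasFDerivAt ν.coneTube D (γ θ) := by rw [hγ0]; exact hD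
      exact hD'.comp_hasDerivAt θ hγ'
    have hexp : HasDerivAt (ν.coneTube ∘ γ) (t • R₂) θ := by
      have heq : (ν.coneTube ∘ γ) = fun s : ℝ ↦ t • G (s, w) := funext fun s ↦ hcone s w
      have hc : HasDerivAt (fun s : ℝ ↦ G (s, w)) R₂ θ := by
        have h := (hGd (θ, w)).comp_hasDerivAt θ ((hasDerivAt_id θ).prodMk (hasDerivAt_const θ w))
        rw [hR₂]
        exact h
      rw [heq]
      exact hc.const_smul t
    exact hcomp.unique hexp
  -- (3), (4) the fibre directions: `D (0, eᵢ) = t • ∂_{wᵢ} ν`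
  have hfib : ∀ v : 𝔼 2, D (0, v) = t • fderiv ℝ G (θ, w) (0, v) := by
    intro v
    set γ : ℝ → (𝔼 2) × (𝔼 2) := fun s ↦ (t • ((circlePoint θ : 𝕊 1) : 𝔼 2), w + s • v) with hγ
    have hγ0 : γ 0 = (x, w) := by simp [hγ, hx]
    have hγ' : HasDerivAt γ ((0 : 𝔼 2), v) 0 := by
      have h1 : HasDerivAt (fun s : ℝ ↦ w + s • v) v 0 := by
        simpa using ((hasDerivAt_id (0 : ℝ)).smul_const v).const_add w
      exact (hasDerivAt_const (0 : ℝ) _).prodMk h1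
    have hcomp : HasDerivAt (ν.coneTube ∘ γ) (D (0, v)) 0 := by
      have hD' : HasFDerivAt ν.coneTube D (γ 0) := by rw [hγ0]; exact hD
      exact hD'.comp_hasDerivAt 0 hγ'
    have hexp : HasDerivAt (ν.coneTube ∘ γ) (t • fderiv ℝ G (θ, w) (0, v)) 0 := by
      have heq : (ν.coneTube ∘ γ) = fun s : ℝ ↦ t • G (θ, w + s • v) := funext fun s ↦ hcone θ _
      have hc : HasDerivAt (fun s : ℝ ↦ G (θ, w + s • v)) (fderiv ℝ G (θ, w) (0, v)) 0 := by
        have hl : HasDerivAt (fun s : ℝ ↦ (θ, w + s • v)) ((0 : ℝ), v) 0 := by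
          have h1 : HasDerivAt (fun s : ℝ ↦ w + s • v) v 0 := by
            simpa using ((hasDerivAt_id (0 : ℝ)).smul_const v).const_add w
          exact (hasDerivAt_const (0 : ℝ) θ).prodMk h1
        have hG0 : HasFDerivAt G (fderiv ℝ G (θ, w)) (θ, w + (0 : ℝ) • v) := by
          rw [zero_smul, add_zero]
          exact hGd (θ, w)
        exact hG0.comp_hasDerivAt (0 : ℝ) hl
      rw [heq]
      exact hc.const_smul t
    exact hcomp.unique hexp
  -- the four rows lie in the image of `D`
  have hm₁ : R₁ ∈ LinearMap.range (D : (𝔼 2) × (𝔼 2) →ₗ[ℝ] 𝔼 4) :=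
    LinearMap.mem_range.2 ⟨(((circlePoint θ : 𝕊 1) : 𝔼 2), 0), h1⟩
  have hm₂ : R₂ ∈ LinearMap.range (D : (𝔼 2) × (𝔼 2) →ₗ[ℝ] 𝔼 4) := by
    refine LinearMap.mem_range.2
      ⟨t⁻¹ • (t • deriv (fun s : ℝ ↦ ((circlePoint s : 𝕊 1) : 𝔼 2)) θ, (0 : 𝔼 2)), ?_⟩
    rw [ContinuousLinearMap.coe_coe, map_smul, h2, smul_smul, inv_mul_cancel₀ ht.ne', one_smul]
  have hm₃ : R₃ ∈ LinearMap.range (D : (𝔼 2) × (𝔼 2) →ₗ[ℝ] 𝔼 4) := by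
    refine LinearMap.mem_range.2 ⟨t⁻¹ • ((0 : 𝔼 2), e₀), ?_⟩
    rw [ContinuousLinearMap.coe_coe, map_smul, hfib e₀, smul_smul, inv_mul_cancel₀ ht.ne', one_smul]
  have hm₄ : R₄ ∈ LinearMap.range (D : (𝔼 2) × (𝔼 2) →ₗ[ℝ] 𝔼 4) := by
    refine LinearMap.mem_range.2 ⟨t⁻¹ • ((0 : 𝔼 2), e₁), ?_⟩
    rw [ContinuousLinearMap.coe_coe, map_smul, hfib e₁, smul_smul, inv_mul_cancel₀ ht.ne', one_smul]
  exact injective_of_frameDet_ne_zero_of_mem_range hdet hm₁ hm₂ hm₃ hm₄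

/-- **The cone tube is a `C^∞` injective immersion of `(ℝ² ∖ 0) × ℝ²` into `ℝ⁴`** (summary).
[folklore] -/
theorem coneTube_immersion :
    ContDiffOn ℝ ∞ ν.coneTube {q : (𝔼 2) × (𝔼 2) | q.1 ≠ 0} ∧
      InjOn ν.coneTube {q : (𝔼 2) × (𝔼 2) | q.1 ≠ 0} ∧
      ∀ q : (𝔼 2) × (𝔼 2), q.1 ≠ 0 → Injective (fderiv ℝ ν.coneTube q) :=
  ⟨ν.contDiffOn_coneTube, ν.injOn_coneTube, fun _ hq ↦ ν.injective_fderiv_coneTube hq⟩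

end Knot.TubularNbhd

end Literature.Topology.FourManifolds
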